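import Summits.HodgeConjecture.CorCM.Census.CentralSquaresPartnersMetric

/-!
# The square-central class, LVII: the tie hypotheses of the multi-partner frame from intersection counts

COR-CM (cell `pub-hodgecm2`), count-neutral kernel combinatorics by the binder seat b09 (gen 50; lane SQUARE-CENTRAL CLASS, part LVII), on part L
(`Census/CentralSquaresPartnersMetric.lean`: `ddist_rt_partners_cases`) and part III (`ddist_eq_card_symmDiff`, `ddist_compl_eq`, `ddist_compl_base_eq`), BY
NAME.  Theorems only: no definition, no `decide`, no certificate, no named fact, no `sorry`.  HONEST FRAMING: `HC_CM` is NOT proved, here or anywhere in the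
tree; nothing here is a period or a headline.

The multi-partner relation theorems (parts LI–LVI) carry TIE HYPOTHESES: at the type whose deviation set is a transversal `T ⊆ 𝓗 = T₀ ∖ T₁` (resp.
`T' ⊆ T₀ ∩ T₁`) of size `m`, the only base changes at distance `m` are `T₀` and `T₁` (resp. `T₀` and `T̄₁`).  In a multi-partner block with `|T₀| = 4m` and
all partners at distance `2m` from `T₀` this is a matter of INTERSECTION COUNTS: the distance from another partner `T₂` to that type is
`3m − 2|T ∩ 𝓗₂|` and from `T̄₂` it is `m + 2|T ∩ 𝓗₂|` (`𝓗₂ = T₀ ∖ T₂`), so both differ from `m` as soon as `0 < |T ∩ 𝓗₂| < m` — in the rank-two affine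
blocks `|T ∩ 𝓗₂| = m/2` for every transversal of a dihedral-type swap (numerics `lean-g50/py/eight3.py`).

* §1 `card_symmDiff_add_two_mul_card_inter`: `|A ∆ B| + 2|A ∩ B| = |A| + |B|`.
* §2 `tie_of_inter_bounds`: the tie hypothesis `hties` of parts LII–LVI for a set `T ⊆ 𝓗` of size `m` meeting every other `𝓗₂` in `1 … m−1` places;
  `tieC_of_inter_bounds`: the companion tie hypothesis `htiesC` for `T' ⊆ T₀ ∩ T₁` likewise.

## References
* [Pohlmann1968] H. Pohlmann, Algebraic cycles on abelian varieties of complex multiplication type, Ann. of Math. 88 (1968), Thm 1.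
-/

namespace Summit.HodgeConjecture.CorCM.Census.CentralSquares

open Finset
open scoped symmDiff
open Summit.HodgeConjecture.CorCM.Prior.AllgGroup.RfwfAllgGroup
open Summit.HodgeConjecture.CorCM.Census.BlockParity
open Summit.HodgeConjecture.CorCM.Census.Coinvariant
open Summit.HodgeConjecture.CorCM.Census.TwistGeneration
open Summit.HodgeConjecture.CorCM.Census.BaseBlock

noncomputable section

variable {G : Type*} [Group G] [Fintype G] [DecidableEq G] (c : G) (T₀ : CMF G c)

/-! ## §1 The cardinality of a symmetric difference -/

omit [Group G] [Fintype G] in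
/-- `|A ∆ B| + 2|A ∩ B| = |A| + |B|`. [folklore] -/
theorem card_symmDiff_add_two_mul_card_inter (A B : Finset G) : (A ∆ B).card + 2 * (A ∩ B).card = A.card + B.card := by
  have h1 : A ∆ B = (A ∪ B) \ (A ∩ B) := symmDiff_eq_sup_sdiff_inf A B
  have h2 : (A ∩ B) ⊆ (A ∪ B) := inter_subset_union
  rw [h1, card_sdiff_of_subset h2]
  have h3 := card_union_add_card_inter A B
  have h4 := card_le_card h2
  omega

/-! ## §2 Ties from intersection counts -/

section Partners

variable (𝒯 : Finset (CMF G c))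
variable (hbase : ∀ Q : G, rt c Q T₀ = T₀ ∨ rt c Q T₀ = rt c c T₀ ∨ ∃ T₁ ∈ 𝒯, rt c Q T₀ = T₁ ∨ rt c Q T₀ = rt c c T₁)
variable (m : ℕ) (hn : T₀.1.card = 4 * m) (hH : ∀ T₁ ∈ 𝒯, (T₀.1 \ T₁.1).card = 2 * m)

include hbase hn hH in
/-- **THE TIE HYPOTHESIS from intersection counts.**  `T₁ ∈ 𝒯`, `T ⊆ 𝓗 = T₀ ∖ T₁` with `|T| = m ≥ 1`, and `0 < |T ∩ 𝓗₂| < m` for every other partner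
`T₂`: at every type `X` with `D(X) = T` the only base changes at distance `m` are `T₀` and `T₁`. [folklore] -/
theorem tie_of_inter_bounds (hc2 : c * c = 1) (hcen : ∀ x : G, x * c = c * x) (hm : 1 ≤ m) {T₁ : CMF G c} (hT₁ : T₁ ∈ 𝒯)
    (T : Finset G) (hTH : T ⊆ T₀.1 \ T₁.1) (hTm : T.card = m)
    (hinter : ∀ T₂ ∈ 𝒯, T₂ ≠ T₁ → 0 < (T ∩ (T₀.1 \ T₂.1)).card ∧ (T ∩ (T₀.1 \ T₂.1)).card < m) :
    ∀ X : CMF G c, T₀.1 \ X.1 = T → ∀ Q' : G, ddist (rt c Q' T₀) X = m → rt c Q' T₀ = T₀ ∨ rt c Q' T₀ = T₁ := by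
  intro X hX Q' hd
  have hsd₁ : ((T₀.1 \ T₁.1) ∆ (T₀.1 \ X.1)).card = m := by
    rw [hX, symmDiff_of_ge hTH, card_sdiff_of_subset hTH, hH T₁ hT₁, hTm]; omega
  rcases hbase Q' with h | h | ⟨T₂, hT₂, h | h⟩
  · exact Or.inl h
  · exfalso; rw [h, ddist_compl_base_eq c T₀ hc2 hcen, hn, hX, hTm] at hd; omega
  · by_cases h12 : T₂ = T₁
    · subst h12; exact Or.inr h
    · exfalso
      rw [h, ddist_eq_card_symmDiff c T₀ hc2, hX] at hd
      have h1 := card_symmDiff_add_two_mul_card_inter (T₀.1 \ T₂.1) T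
      rw [inter_comm] at h1
      have h2 := hH T₂ hT₂
      have h3 := (hinter T₂ hT₂ h12).2
      omega
  · by_cases h12 : T₂ = T₁
    · subst h12; exfalso; rw [h, ddist_compl_eq c T₀ hc2 hcen, hn, hsd₁] at hd; omega
    · exfalso
      rw [h, ddist_compl_eq c T₀ hc2 hcen, hn, hX] at hd
      have h1 := card_symmDiff_add_two_mul_card_inter (T₀.1 \ T₂.1) T
      rw [inter_comm] at h1
      have h2 := hH T₂ hT₂
      have h3 := (hinter T₂ hT₂ h12).1
      have h4 : ((T₀.1 \ T₂.1) ∆ T).card ≤ (T₀.1 \ T₂.1).card + T.card := card_symmDiff_le_add _ _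
      omega

include hbase hn hH in
/-- **THE COMPANION TIE HYPOTHESIS from intersection counts.**  `T₁ ∈ 𝒯`, `T' ⊆ T₀ ∩ T₁` with `|T'| = m ≥ 1`, and `0 < |T' ∩ 𝓗₂| < m` for every other
partner `T₂`: at every type `X` with `D(X) = T'` the only base changes at distance `m` are `T₀` and `T̄₁`. [folklore] -/
theorem tieC_of_inter_bounds (hc2 : c * c = 1) (hcen : ∀ x : G, x * c = c * x) (hm : 1 ≤ m) {T₁ : CMF G c} (hT₁ : T₁ ∈ 𝒯)
    (T' : Finset G) (hTH : T' ⊆ T₀.1 ∩ T₁.1) (hTm : T'.card = m)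
    (hinter : ∀ T₂ ∈ 𝒯, T₂ ≠ T₁ → 0 < (T' ∩ (T₀.1 \ T₂.1)).card ∧ (T' ∩ (T₀.1 \ T₂.1)).card < m) :
    ∀ X : CMF G c, T₀.1 \ X.1 = T' → ∀ Q' : G, ddist (rt c Q' T₀) X = m → rt c Q' T₀ = T₀ ∨ rt c Q' T₀ = rt c c T₁ := by
  intro X hX Q' hd
  have hdisj : Disjoint (T₀.1 \ T₁.1) T' := by
    rw [disjoint_iff_ne]; rintro x hx y hy rfl; exact (mem_sdiff.mp hx).2 (mem_inter.mp (hTH hy)).2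
  have hsd₁ : ((T₀.1 \ T₁.1) ∆ (T₀.1 \ X.1)).card = 3 * m := by
    rw [hX]
    have h1 := card_symmDiff_add_two_mul_card_inter (T₀.1 \ T₁.1) T'
    rw [disjoint_iff_inter_eq_empty.mp hdisj, card_empty, hH T₁ hT₁, hTm] at h1
    omega
  rcases hbase Q' with h | h | ⟨T₂, hT₂, h | h⟩
  · exact Or.inl h
  · exfalso; rw [h, ddist_compl_base_eq c T₀ hc2 hcen, hn, hX, hTm] at hd; omega
  · by_cases h12 : T₂ = T₁
    · subst h12; exfalso; rw [h, ddist_eq_card_symmDiff c T₀ hc2, hsd₁] at hd; omega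
    · exfalso
      rw [h, ddist_eq_card_symmDiff c T₀ hc2, hX] at hd
      have h1 := card_symmDiff_add_two_mul_card_inter (T₀.1 \ T₂.1) T'
      rw [inter_comm] at h1
      have h2 := hH T₂ hT₂
      have h3 := (hinter T₂ hT₂ h12).2
      omega
  · by_cases h12 : T₂ = T₁
    · subst h12; exact Or.inr h
    · exfalso
      rw [h, ddist_compl_eq c T₀ hc2 hcen, hn, hX] at hd
      have h1 := card_symmDiff_add_two_mul_card_inter (T₀.1 \ T₂.1) T'
      rw [inter_comm] at h1
      have h2 := hH T₂ hT₂
      have h3 := (hinter T₂ hT₂ h12).1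
      have h4 : ((T₀.1 \ T₂.1) ∆ T').card ≤ (T₀.1 \ T₂.1).card + T'.card := card_symmDiff_le_add _ _
      omega

end Partners

end

end Summit.HodgeConjecture.CorCM.Census.CentralSquares
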